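import Summits.AtomisticToContinuum.FouriersLaw.Theorems.BondHeatUncertaintyExtensiveSnapshotIrreversibilityEnergyWindowCostateObservabilityA
import HarnessLib

/-!
# Energy window — (T) CostateObservability ((COF) PROVED ⇒ (EBF) ⇒ (MC∞)) — part 2 of 2 (sequel of `…BondHeatUncertaintyExtensiveSnapshotIrreversibilityEnergyWindowCostateObservabilityA`)

Split for the 400-line cap by the landing lane (hand-2 g32); the module docstring of part 1 (`…BondHeatUncertaintyExtensiveSnapshotIrreversibilityEnergyWindowCostateObservabilityA`) describes the whole node.  Same namespace; all FQNs unchanged.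
0 sorry; standard axioms.
-/


namespace Summit.AtomisticToContinuum.FouriersLaw.Theorems.ExtensiveSnapshotIrreversibility.EnergyWindow

open MeasureTheory Filter Topology Set Finset
open scoped Nat
open Literature.MathematicalPhysics.KineticTheory.HeatConduction Literature.Probability.Process

/-! ## 5. (COF): the closure by the free parameter `η` -/

section Closure

variable {ω₂ lam β γ : ℝ}

/-- Real arithmetic: the master constant `W = C_W Θ²` dominates the five quantities the links
need (`16`, `2γ`, `NΛ`, `8(1+2γ)S/n`, `(NΛ + 2γ(1+2γ))S/n`, and `A_α S²/n² ≤ W²`). -/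
theorem master_dominations {γ Nr CΛ CD K₁ Θ n tθ CW : ℝ} (hγ : 0 ≤ γ) (hN : 0 ≤ Nr)
    (hCΛ : 0 ≤ CΛ) (hK₁ : 0 ≤ K₁) (hΘ1 : 1 ≤ Θ) (hn : 0 ≤ n) (htθ : 0 ≤ tθ)
    (hCW : 16 + 2 * γ + Nr * CΛ + 8 * ((1 + 2 * γ) * K₁) + (Nr * CΛ + 2 * γ * (1 + 2 * γ)) * K₁ +
      (2 * (Nr * Nr) * ((1 + 2 * γ) ^ 2 * CΛ ^ 2 + CD ^ 2 * tθ) * K₁ ^ 2 + 1) ≤ CW) :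
    16 ≤ CW * Θ ^ 2 ∧ 2 * γ ≤ CW * Θ ^ 2 ∧ Nr * (CΛ * Θ) ≤ CW * Θ ^ 2 ∧
      8 * ((1 + 2 * γ) * (K₁ * Θ * n)) ≤ CW * Θ ^ 2 * n ∧
      ((Nr * (CΛ * Θ) + 2 * γ * (1 + 2 * γ)) * (K₁ * Θ * n)) ^ 2 ≤ (CW * Θ ^ 2) ^ 2 * n ^ 2 ∧
      2 * (Nr * Nr) * ((1 + 2 * γ) ^ 2 * (CΛ * Θ) ^ 2 + CD ^ 2 * tθ * Θ) * (K₁ * Θ * n) ^ 2 ≤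
        (CW * Θ ^ 2) ^ 2 * n ^ 2 := by
  have hΘ0 : 0 ≤ Θ := zero_le_one.trans hΘ1
  have hΘsq : Θ ≤ Θ ^ 2 := le_self_pow₀ hΘ1 two_ne_zero
  have hΘsq1 : 1 ≤ Θ ^ 2 := hΘ1.trans hΘsq
  have hc2 : 0 ≤ Nr * CΛ := by positivity
  have hc3 : 0 ≤ 8 * ((1 + 2 * γ) * K₁) := by positivity
  have hc4 : 0 ≤ (Nr * CΛ + 2 * γ * (1 + 2 * γ)) * K₁ := by positivity
  have hc5 : 0 ≤ 2 * (Nr * Nr) * ((1 + 2 * γ) ^ 2 * CΛ ^ 2 + CD ^ 2 * tθ) * K₁ ^ 2 := by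
    positivity
  have hCW16 : 16 ≤ CW := by linarith
  have hCW0 : 0 ≤ CW := by linarith
  have hCWW : CW ≤ CW * Θ ^ 2 := le_mul_of_one_le_right hCW0 hΘsq1
  have hS0 : 0 ≤ K₁ * Θ * n := by positivity
  refine ⟨hCW16.trans hCWW, le_trans (by linarith) hCWW, ?_, ?_, ?_, ?_⟩
  · calc Nr * (CΛ * Θ) = Nr * CΛ * Θ := by ring
      _ ≤ CW * Θ ^ 2 := mul_le_mul (by linarith) hΘsq hΘ0 hCW0
  · calc 8 * ((1 + 2 * γ) * (K₁ * Θ * n)) = 8 * ((1 + 2 * γ) * K₁) * Θ * n := by ring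
      _ ≤ CW * Θ ^ 2 * n :=
          mul_le_mul_of_nonneg_right (mul_le_mul (by linarith) hΘsq hΘ0 hCW0) hn
  · have hM0 : 0 ≤ (Nr * (CΛ * Θ) + 2 * γ * (1 + 2 * γ)) * (K₁ * Θ * n) := by positivity
    have h1 : Nr * (CΛ * Θ) + 2 * γ * (1 + 2 * γ) ≤ (Nr * CΛ + 2 * γ * (1 + 2 * γ)) * Θ := by
      have h2 : 2 * γ * (1 + 2 * γ) * 1 ≤ 2 * γ * (1 + 2 * γ) * Θ :=
        mul_le_mul_of_nonneg_left hΘ1 (by positivity)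
      have h3 : (Nr * CΛ + 2 * γ * (1 + 2 * γ)) * Θ =
          Nr * (CΛ * Θ) + 2 * γ * (1 + 2 * γ) * Θ := by ring
      rw [h3]; linarith
    have hM : (Nr * (CΛ * Θ) + 2 * γ * (1 + 2 * γ)) * (K₁ * Θ * n) ≤ CW * Θ ^ 2 * n :=
      calc (Nr * (CΛ * Θ) + 2 * γ * (1 + 2 * γ)) * (K₁ * Θ * n)
          ≤ (Nr * CΛ + 2 * γ * (1 + 2 * γ)) * Θ * (K₁ * Θ * n) :=
            mul_le_mul_of_nonneg_right h1 hS0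
        _ = (Nr * CΛ + 2 * γ * (1 + 2 * γ)) * K₁ * Θ ^ 2 * n := by ring
        _ ≤ CW * Θ ^ 2 * n :=
            mul_le_mul_of_nonneg_right
              (mul_le_mul_of_nonneg_right (by linarith) (by positivity)) hn
    calc ((Nr * (CΛ * Θ) + 2 * γ * (1 + 2 * γ)) * (K₁ * Θ * n)) ^ 2 ≤ (CW * Θ ^ 2 * n) ^ 2 :=
          pow_le_pow_left₀ hM0 hM 2
      _ = (CW * Θ ^ 2) ^ 2 * n ^ 2 := by ring
  · have h1 : (1 + 2 * γ) ^ 2 * (CΛ * Θ) ^ 2 + CD ^ 2 * tθ * Θ ≤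
        ((1 + 2 * γ) ^ 2 * CΛ ^ 2 + CD ^ 2 * tθ) * Θ ^ 2 := by
      have h2 : CD ^ 2 * tθ * Θ ≤ CD ^ 2 * tθ * Θ ^ 2 :=
        mul_le_mul_of_nonneg_left hΘsq (by positivity)
      have h3 : ((1 + 2 * γ) ^ 2 * CΛ ^ 2 + CD ^ 2 * tθ) * Θ ^ 2 =
          (1 + 2 * γ) ^ 2 * (CΛ * Θ) ^ 2 + CD ^ 2 * tθ * Θ ^ 2 := by ring
      rw [h3]; linarith
    have hCW2 : CW ≤ CW ^ 2 := le_self_pow₀ (by linarith) two_ne_zero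
    calc 2 * (Nr * Nr) * ((1 + 2 * γ) ^ 2 * (CΛ * Θ) ^ 2 + CD ^ 2 * tθ * Θ) * (K₁ * Θ * n) ^ 2
        ≤ 2 * (Nr * Nr) * (((1 + 2 * γ) ^ 2 * CΛ ^ 2 + CD ^ 2 * tθ) * Θ ^ 2) *
            (K₁ * Θ * n) ^ 2 := by gcongr
      _ = 2 * (Nr * Nr) * ((1 + 2 * γ) ^ 2 * CΛ ^ 2 + CD ^ 2 * tθ) * K₁ ^ 2 * (Θ ^ 2) ^ 2 *
            n ^ 2 := by ring
      _ ≤ CW * (Θ ^ 2) ^ 2 * n ^ 2 := by gcongr; linarith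
      _ ≤ CW ^ 2 * (Θ ^ 2) ^ 2 * n ^ 2 := by gcongr
      _ = (CW * Θ ^ 2) ^ 2 * n ^ 2 := by ring

/-- Real arithmetic: the closure by the free parameter.  If for every `η ∈ [0, 1]` the
observation hypothesis `I ≤ (n η^{e})²` forces `n ≤ W^p n η²`, then `n² ≤ (2 W^p)^{2e} I`
(take `η₀ = 1 / (2 W^p)`: either the hypothesis holds and then `n ≤ n / 4`, or it fails). -/
theorem sq_le_of_transfer {n W I : ℝ} {pN eN : ℕ} (hn0 : 0 ≤ n) (hW1 : 1 ≤ W) (hI0 : 0 ≤ I)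
    (key : ∀ η : ℝ, 0 ≤ η → η ≤ 1 → I ≤ (n * η ^ eN) ^ 2 → n ≤ W ^ pN * n * η ^ 2) :
    n ^ 2 ≤ (2 * W ^ pN) ^ (2 * eN) * I := by
  have hW0 : 0 < W := by linarith
  have hWp1 : 1 ≤ W ^ pN := one_le_pow₀ hW1
  have hWp0 : 0 < W ^ pN := by positivity
  set η₀ : ℝ := 1 / (2 * W ^ pN) with hη₀
  have hη₀0 : 0 < η₀ := by positivity
  have hη₀1 : η₀ ≤ 1 := by rw [hη₀, div_le_one (by positivity)]; linarith
  have hη₀W : η₀ * (2 * W ^ pN) = 1 := by rw [hη₀]; field_simp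
  by_cases hcase : I ≤ (n * η₀ ^ eN) ^ 2
  · have h := key η₀ hη₀0.le hη₀1 hcase
    have hq : W ^ pN * η₀ ^ 2 ≤ 1 / 4 := by
      have h4 : W ^ pN * η₀ ^ 2 = 1 / (4 * W ^ pN) := by rw [hη₀]; field_simp; ring
      rw [h4]
      exact div_le_div_of_nonneg_left (by norm_num) (by norm_num) (by linarith)
    have hn' : n ≤ n * (1 / 4) :=
      calc n ≤ W ^ pN * n * η₀ ^ 2 := h
        _ = n * (W ^ pN * η₀ ^ 2) := by ring
        _ ≤ n * (1 / 4) := mul_le_mul_of_nonneg_left hq hn0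
    have hn00 : n = 0 := le_antisymm (by linarith) hn0
    rw [hn00, zero_pow two_ne_zero]
    positivity
  · push Not at hcase
    calc n ^ 2 = (n * η₀ ^ eN) ^ 2 * (2 * W ^ pN) ^ (2 * eN) := by
          rw [show (n * η₀ ^ eN) ^ 2 * (2 * W ^ pN) ^ (2 * eN) =
            n ^ 2 * (η₀ * (2 * W ^ pN)) ^ (2 * eN) by ring, hη₀W, one_pow, mul_one]
      _ ≤ I * (2 * W ^ pN) ^ (2 * eN) := mul_le_mul_of_nonneg_right hcase.le (by positivity)
      _ = (2 * W ^ pN) ^ (2 * eN) * I := mul_comm _ _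

/-- **(COF) for fixed parameters — PROVED.** [NEW · closes the open leaf beneath (MC∞)] -/
theorem costateObservabilityFloorBody_holds (hω : 0 < ω₂) (hl : 0 < lam) (hβ : 0 < β)
    (hγ : 0 < γ) : CostateObservabilityFloorBody ω₂ lam β γ := by
  intro T hT N hN
  -- the exponents (natural numbers, functions of `N` alone)
  obtain ⟨pN, hpN⟩ : ∃ pN : ℕ, pN = 4 * (N - 1) + 1 + 1 + 1 := ⟨_, rfl⟩
  obtain ⟨eN, heN⟩ : ∃ eN : ℕ, eN = 9 ^ N := ⟨_, rfl⟩
  refine ⟨((2 * pN * (2 * eN) : ℕ) : ℝ), 1, ?_, one_pos, fun θ hθ => ?_⟩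
  · have h : 0 < 2 * pN * (2 * eN) := by subst hpN; subst heN; positivity
    exact_mod_cast h
  obtain ⟨K₁, hK₁, hK⟩ := IsPathCostate.norm_le_budget hω hl.le hβ.le hγ.le N hθ one_pos
  -- the constants (functions of `θ`, `N` and the parameters alone)
  set CΛ : ℝ := (ω₂ + (N : ℝ) * N) +
    (3 * lam + (N : ℝ) * N * (12 * β)) * (4 * (1 + 1 / ω₂) * (1 / θ)) with hCΛ
  set CD : ℝ := 6 * lam * (1 + 1 / ω₂) + (N : ℝ) * N * (24 * β) with hCD
  set CW : ℝ := 16 + 2 * γ + (N : ℝ) * CΛ + 8 * ((1 + 2 * γ) * K₁) +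
    ((N : ℝ) * CΛ + 2 * γ * (1 + 2 * γ)) * K₁ +
    (2 * ((N : ℝ) * N) * ((1 + 2 * γ) ^ 2 * CΛ ^ 2 + CD ^ 2 * ((2 : ℝ) / θ ^ 2)) * K₁ ^ 2 + 1)
    with hCW
  have hK₁0 : 0 ≤ K₁ := hK₁.le
  have hCΛ0 : 0 ≤ CΛ := by rw [hCΛ]; positivity
  have hCWpos : 0 < CW := by rw [hCW]; positivity
  refine ⟨(2 * N + 1) * (2 * CW ^ pN) ^ (2 * eN), by positivity,
    fun δ hδ s hs hs1 z wp c hc => ?_⟩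
  -- the data of this path: budget `Θ ≥ 1`, `n = ‖c(s)‖`, master constant `W = C_W Θ²`
  have hs0 : 0 < s := by linarith
  set Θ := energyBudget ω₂ lam β γ N (T + δ / 2) (T - δ / 2) θ z wp with hΘ
  have hΘ1 : 1 ≤ Θ :=
    one_le_energyBudget (T_L := T + δ / 2) (T_R := T - δ / 2) hω hl.le hβ.le hγ.le hθ.le z wp
  have hΘ0 : 0 ≤ Θ := zero_le_one.trans hΘ1
  set n := ‖c s‖ with hn
  have hn0 : 0 ≤ n := norm_nonneg _
  obtain ⟨hW16, hWγ, hWΛ, hWS, hWM, hWA⟩ := master_dominations (CD := CD) (tθ := (2 : ℝ) / θ ^ 2)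
    hγ.le (Nat.cast_nonneg N) hCΛ0 hK₁0 hΘ1 hn0 (by positivity) (le_of_eq hCW.symm)
  -- a-priori bound (part M, `μ₀ = 1`) and Hessian sup bound (part Q)
  have hS : ∀ t ∈ Icc 0 s, ‖c t‖ ≤ K₁ * Θ * n := by
    intro t ht
    have h := hK (T + δ / 2) (T - δ / 2) s hs0 hs1 z wp c hc t ht
    rwa [Real.rpow_one] at h
  have hS0 : 0 ≤ K₁ * Θ * n := by positivity
  have hΛ : ∀ t ∈ Icc 0 s, ∀ i j, |(pinnedChain ω₂ lam β γ).hessPotential N i j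
      ((pinnedChain ω₂ lam β γ).solMap N (T + δ / 2) (T - δ / 2) t z (pairPath wp)).1| ≤
        CΛ * Θ := by
    intro t ht i j
    have ht1 : t ∈ Icc (0 : ℝ) 1 := ⟨ht.1, ht.2.trans hs1⟩
    refine (abs_hessPotential_solMap_le hω hl.le hβ.le hγ.le N (T + δ / 2) (T - δ / 2) hθ z wp
      i j ht1).trans ?_
    have h1 : (ω₂ + (N : ℝ) * N) * 1 ≤ (ω₂ + (N : ℝ) * N) * Θ :=
      mul_le_mul_of_nonneg_left hΘ1 (by positivity)
    calc (ω₂ + (N : ℝ) * N) + (3 * lam + (N : ℝ) * N * (12 * β)) *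
          (4 * (1 + 1 / ω₂) * (1 / θ * Θ))
        = (ω₂ + (N : ℝ) * N) * 1 +
          (3 * lam + (N : ℝ) * N * (12 * β)) * (4 * (1 + 1 / ω₂) * (1 / θ)) * Θ := by ring
      _ ≤ (ω₂ + (N : ℝ) * N) * Θ +
          (3 * lam + (N : ℝ) * N * (12 * β)) * (4 * (1 + 1 / ω₂) * (1 / θ)) * Θ :=
          add_le_add h1 le_rfl
      _ = CΛ * Θ := by rw [hCΛ]; ring
  have hΛ0 : 0 ≤ CΛ * Θ := by positivity
  -- the transfer (§4) at every `η ∈ [0, 1]`, then the closure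
  have key : ∀ η : ℝ, 0 ≤ η → η ≤ 1 →
      ∫ u in (0 : ℝ)..s, ((c u).2 ⟨0, by omega⟩) ^ 2 ≤ (n * η ^ eN) ^ 2 →
        n ≤ (CW * Θ ^ 2) ^ pN * n * η ^ 2 := by
    intro η hη0 hη1 hI
    rw [heN] at hI
    rw [hpN]
    exact hc.norm_le_of_integral_sq_le hω hl.le hβ.le hγ.le hθ hs hs1 hS0 hS hΛ0 hΛ hW16 hη0 hη1
      hWγ hWΛ hWS hWM hWA (i₀ := ⟨0, by omega⟩) rfl hI
  have hI0 : 0 ≤ ∫ u in (0 : ℝ)..s, ((c u).2 ⟨0, by omega⟩) ^ 2 :=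
    intervalIntegral.integral_nonneg hs0.le fun u _ => sq_nonneg _
  have hn2 := sq_le_of_transfer hn0 (le_trans (by norm_num) hW16) hI0 key
  -- assemble: `dualPair (c s) (c s) ≤ 2N n² ≤ K Θ^μ ∫ β_0²`
  have hdp : dualPair (c s) (c s) ≤ 2 * N * n ^ 2 := dualPair_self_le N (c s)
  have hWpow : (2 * (CW * Θ ^ 2) ^ pN) ^ (2 * eN) =
      (2 * CW ^ pN) ^ (2 * eN) * Θ ^ (2 * pN * (2 * eN)) := by
    rw [mul_pow 2 (CW ^ pN), mul_pow CW, ← pow_mul Θ, mul_pow 2, mul_pow (CW ^ pN), ← pow_mul CW,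
      ← pow_mul Θ]
    ring
  rw [Real.rpow_natCast]
  calc dualPair (c s) (c s) ≤ 2 * N * n ^ 2 := hdp
    _ ≤ 2 * N * ((2 * (CW * Θ ^ 2) ^ pN) ^ (2 * eN) *
        ∫ u in (0 : ℝ)..s, ((c u).2 ⟨0, by omega⟩) ^ 2) := by gcongr
    _ ≤ (2 * N + 1) * ((2 * (CW * Θ ^ 2) ^ pN) ^ (2 * eN) *
        ∫ u in (0 : ℝ)..s, ((c u).2 ⟨0, by omega⟩) ^ 2) :=
        mul_le_mul_of_nonneg_right (by linarith) (by positivity)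
    _ = (2 * N + 1) * (2 * CW ^ pN) ^ (2 * eN) * Θ ^ (2 * pN * (2 * eN)) *
        ∫ u in (0 : ℝ)..s, ((c u).2 ⟨0, by omega⟩) ^ 2 := by rw [hWpow]; ring

/-- **(COF) `CostateObservabilityFloor` — PROVED** (the open leaf of the g84 node). -/
theorem costateObservabilityFloor : CostateObservabilityFloor :=
  fun _ _ _ _ hω hl hβ hγ => costateObservabilityFloorBody_holds hω hl hβ hγ

/-- **(EBF) `EnergyBudgetGramFloor` — PROVED** ((CSF) part K ∧ (COF)). -/
theorem energyBudgetGramFloor_proved : EnergyBudgetGramFloor :=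
  energyBudgetGramFloor_of_costateObservabilityFloor costateObservabilityFloor

/-- **(MC∞) `SkeletonGramLimitInverseMoments` — PROVED**: the binder of record beneath
(MD₂) ⟸ (KD₂) ⟸ S3 (critic rows 1188/1193) — inverse moments of ALL orders of the limiting
skeleton Gram floor, for the pinned anharmonic chain at every `ω₂, lam, β, γ > 0`, every
`T > 0` and every `N ≥ 2`. -/
theorem skeletonGramLimitInverseMoments_proved : SkeletonGramLimitInverseMoments :=
  skeletonGramLimitInverseMoments_of_costateObservabilityFloor costateObservabilityFloor

end Closure

end Summit.AtomisticToContinuum.FouriersLaw.Theorems.ExtensiveSnapshotIrreversibility.EnergyWindow
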